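import Summits.Ventures.Crystal3D.Theorems.StickyWulffConstantCoaxialWallLawOneFccLayerLines
import Summits.Ventures.Crystal3D.Theorems.StickyWulffConstantGenericWallFloorBarlowZigzagCrossings
import Summits.Ventures.Crystal3D.Theorems.StickyWulffConstantCoaxialWallLawTilt
import Summits.Ventures.Crystal3D.Theorems.StickyWulffConstantCoaxialWallLawTwinFrames
import HarnessLib

/-!
# Lattice lines of a whole PLATE: summing the one-layer counts over layers (F_layer OneFcc, flux file (e))

HONEST FRAMING. Venture `Summits/Ventures/Crystal3D` (cell `crystal3d-full`); helper `--supports` the crux `CoaxialWallLaw`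
(stmt-Ventures-19481, REGISTERED line `WallLedgerF`) in its role as owner of lane T's debt T-F2 / F_layer, OneFcc half; memo
HOME/wall-19481-p1/g16/TWO-FAMILY-LEDGER-g16.md §Ledger.  Elementary lattice geometry, standard axioms; nothing about the crux is claimed;
F-C1 not moved.

The one-layer counts `layer_tops_ge` / `layer_firstAbove_le` (…OneFccLayerLines) are stated for an abstract layer
`{L (base + i r + j r') + s}`.  Here they are instantiated on the layers `k` of a moved Barlow plate `stacking L s σ` — layer `k` is
`{L (barlowPos σ k i j) + s}`, i.e. `base = barlowPos σ k 0 0` and `(r, r')` a unimodular basis of the in-plane lattice `ℤu + ℤv` — and summed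
over a finite set of layers:
* `inPlane_slot_basis` — an in-plane slot `r` (`r ∈ fccSlots`, `r₂ = 0`) is `α u + β v` with a partner `r' = α' u + β' v`, `αβ' − α'β = ±1`,
  `r'₂ = 0`, `det(r, r')² = 3/4` (the six cases `±u, ±v, ±(u − v)`);
* `layer_eq_span` — `{barlowPos σ k x y} = {barlowPos σ k 0 0 + i r + j r'}` (both inclusions, explicit coefficients);
* **`plate_tops_ge`** — for a finite set `K` of layers and a finite `P` containing every site of those layers of height in `(z₀ − 1, z₀]`
  within lateral radius `R + 1`: the sites of `P` on layers in `K` that are tops for `z₀` along `L r` number `≥ Σ_{k ∈ K} (Λ_k − 1)`;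
* **`plate_firstAbove_le`** — a finite set of sites on layers in `K`, each the first site of its `r`-line at height `≥ z₁`, within lateral
  radius `R`, numbers `≤ Σ_{k ∈ K} (Λ_k + 1)`;
here `Λ_k = 4 (L r)₂ √((R'² S² − (k d + (L⁻¹ s)₂ − z ν₂)²)₊) / (√3 S²)` is the per-layer count of …OneFccLayerLines with `c_k = k d + (L⁻¹ s)₂`.
WHAT THIS IS NOT: not the sum over roots, not the charge comparison; F-C1 not moved.
-/

noncomputable section

namespace Summit.Ventures.Crystal3D.Theorems

open Summit.Ventures.Crystal3D Finset
open Literature.MathematicalPhysics.StatisticalMechanics (barlowPos barlowStacking constHagg triangularVec₁ triangularVec₂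
  barlowPos_apply_two haggLabel_zero)
open scoped InnerProductSpace

/-- **An in-plane slot is an integer combination of `u, v` with a unimodular partner.** -/
theorem inPlane_slot_basis {r : EuclideanSpace ℝ (Fin 3)} (hr : r ∈ fccSlots) (hr2 : r 2 = 0) :
    ∃ (α β α' β' : ℤ) (r' : EuclideanSpace ℝ (Fin 3)),
      r = (α : ℝ) • triangularVec₁ 1 + (β : ℝ) • triangularVec₂ 1 ∧
      r' = (α' : ℝ) • triangularVec₁ 1 + (β' : ℝ) • triangularVec₂ 1 ∧
      (α * β' - α' * β = 1 ∨ α * β' - α' * β = -1) ∧ r' 2 = 0 ∧ (r 0 * r' 1 - r 1 * r' 0) ^ 2 = 3 / 4 := by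
  classical
  obtain ⟨hu0, hu1, hu2⟩ := triangularVec₁_one_apply
  obtain ⟨hv0, hv1, hv2⟩ := triangularVec₂_one_apply
  have h3 : Real.sqrt 3 ^ 2 = 3 := Real.sq_sqrt (by norm_num)
  have hd : Real.sqrt (2 / 3) ≠ 0 := (Real.sqrt_pos.2 (by norm_num)).ne'
  rw [fccSlots, mem_image] at hr
  obtain ⟨c, hc, rfl⟩ := hr
  rw [barlowPos_apply_two] at hr2
  simp only [fccSlotTriples, mem_insert, mem_singleton] at hc
  -- generic constructor for an in-plane slot `barlowPos 0 i j = i u + j v`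
  have key : ∀ (i j α' β' : ℤ), (i * β' - α' * j = 1 ∨ i * β' - α' * j = -1) →
      ∃ (α β α'' β'' : ℤ) (r' : EuclideanSpace ℝ (Fin 3)),
        barlowPos 1 (Real.sqrt (2 / 3)) constHagg 0 i j = (α : ℝ) • triangularVec₁ 1 + (β : ℝ) • triangularVec₂ 1 ∧
        r' = (α'' : ℝ) • triangularVec₁ 1 + (β'' : ℝ) • triangularVec₂ 1 ∧
        (α * β'' - α'' * β = 1 ∨ α * β'' - α'' * β = -1) ∧ r' 2 = 0 ∧
        (barlowPos 1 (Real.sqrt (2 / 3)) constHagg 0 i j 0 * r' 1 - barlowPos 1 (Real.sqrt (2 / 3)) constHagg 0 i j 1 * r' 0) ^ 2 =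
          3 / 4 := by
    intro i j α' β' hdet
    have hr : barlowPos 1 (Real.sqrt (2 / 3)) constHagg 0 i j = (i : ℝ) • triangularVec₁ 1 + (j : ℝ) • triangularVec₂ 1 := by
      have h := barlowPos_add_inplane 1 (Real.sqrt (2 / 3)) constHagg 0 0 0 i j
      rw [zero_add, zero_add] at h
      rw [← h]
      have h0 : barlowPos 1 (Real.sqrt (2 / 3)) constHagg 0 0 0 = 0 := by
        simp [barlowPos, haggLabel_zero]
      rw [h0, zero_add]
    refine ⟨i, j, α', β', (α' : ℝ) • triangularVec₁ 1 + (β' : ℝ) • triangularVec₂ 1, hr, rfl, hdet, ?_, ?_⟩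
    · simp [hu2, hv2]
    · rw [hr]
      simp only [PiLp.add_apply, PiLp.smul_apply, smul_eq_mul, hu0, hu1, hv0, hv1]
      have hdet' : ((i : ℝ) * β' - α' * j) ^ 2 = 1 := by
        rcases hdet with h | h
        · have : ((i * β' - α' * j : ℤ) : ℝ) = 1 := by exact_mod_cast h
          push_cast at this; rw [this]; norm_num
        · have : ((i * β' - α' * j : ℤ) : ℝ) = -1 := by exact_mod_cast h
          push_cast at this; rw [this]; norm_num
      nlinarith [hdet', h3]
  rcases hc with rfl | rfl | rfl | rfl | rfl | rfl | rfl | rfl | rfl | rfl | rfl | rfl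
  · exact key 1 0 0 1 (by norm_num)
  · exact key 0 1 1 0 (by norm_num)
  · simp at hr2
  · exact key 1 (-1) 0 1 (by norm_num)
  · simp at hr2
  · simp at hr2
  · exact key (-1) 0 0 1 (by norm_num)
  · exact key 0 (-1) 1 0 (by norm_num)
  · simp at hr2
  · exact key (-1) 1 0 1 (by norm_num)
  · simp at hr2
  · simp at hr2

/-- **Every site of layer `k` lies on the span of the basis `(r, r')` from `barlowPos σ k 0 0`**, and conversely. -/
theorem layer_eq_span (σ : ℤ → ℤ) (k : ℤ) {α β α' β' : ℤ} {r r' : EuclideanSpace ℝ (Fin 3)}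
    (hr : r = (α : ℝ) • triangularVec₁ 1 + (β : ℝ) • triangularVec₂ 1)
    (hr' : r' = (α' : ℝ) • triangularVec₁ 1 + (β' : ℝ) • triangularVec₂ 1)
    (hdet : α * β' - α' * β = 1 ∨ α * β' - α' * β = -1) :
    (∀ x y : ℤ, ∃ i j : ℤ, barlowPos 1 (Real.sqrt (2 / 3)) σ k x y =
        barlowPos 1 (Real.sqrt (2 / 3)) σ k 0 0 + (i : ℝ) • r + (j : ℝ) • r') ∧
    (∀ i j : ℤ, barlowPos 1 (Real.sqrt (2 / 3)) σ k 0 0 + (i : ℝ) • r + (j : ℝ) • r' =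
        barlowPos 1 (Real.sqrt (2 / 3)) σ k (α * i + α' * j) (β * i + β' * j)) := by
  have conv : ∀ i j : ℤ, barlowPos 1 (Real.sqrt (2 / 3)) σ k 0 0 + (i : ℝ) • r + (j : ℝ) • r' =
      barlowPos 1 (Real.sqrt (2 / 3)) σ k (α * i + α' * j) (β * i + β' * j) := by
    intro i j
    have h := barlowPos_add_inplane 1 (Real.sqrt (2 / 3)) σ k 0 0 (α * i + α' * j) (β * i + β' * j)
    rw [zero_add, zero_add] at h
    rw [← h, hr, hr']
    push_cast
    module
  refine ⟨fun x y => ?_, conv⟩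
  obtain ⟨sg, hsg⟩ : ∃ sg : ℤ, α * β' - α' * β = sg ∧ sg * sg = 1 := by
    rcases hdet with h | h
    · exact ⟨1, h, by norm_num⟩
    · exact ⟨-1, h, by norm_num⟩
  refine ⟨sg * (β' * x - α' * y), sg * (α * y - β * x), ?_⟩
  rw [conv]
  congr 1
  · linear_combination (-x) * hsg.2 - x * sg * hsg.1
  · linear_combination (-y) * hsg.2 - y * sg * hsg.1

section Plate

variable (σ : ℤ → ℤ) (L : EuclideanSpace ℝ (Fin 3) ≃ₗᵢ[ℝ] EuclideanSpace ℝ (Fin 3)) (s : EuclideanSpace ℝ (Fin 3))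
  {r : EuclideanSpace ℝ (Fin 3)} (hr : r ∈ fccSlots) (hr2 : r 2 = 0) (ha : 0 < (L r) 2)

include hr hr2 ha

open scoped Classical in
/-- **PLATE TOPS FROM BELOW.**  See the module docstring. -/
theorem plate_tops_ge (z₀ R : ℝ) (hR : 0 ≤ R) (K : Finset ℤ) (P : Finset (EuclideanSpace ℝ (Fin 3)))
    (hP : ∀ k ∈ K, ∀ i j : ℤ, z₀ - 1 < (L (barlowPos 1 (Real.sqrt (2 / 3)) σ k i j) + s) 2 →
      (L (barlowPos 1 (Real.sqrt (2 / 3)) σ k i j) + s) 2 ≤ z₀ →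
      (L (barlowPos 1 (Real.sqrt (2 / 3)) σ k i j) + s) 0 ^ 2 + (L (barlowPos 1 (Real.sqrt (2 / 3)) σ k i j) + s) 1 ^ 2 ≤
        (R + 1) ^ 2 →
      L (barlowPos 1 (Real.sqrt (2 / 3)) σ k i j) + s ∈ P) :
    ∑ k ∈ K, (4 * (L r) 2 * Real.sqrt (max 0 (R ^ 2 * (1 - (L.symm (EuclideanSpace.single (2 : Fin 3) (1 : ℝ))) 2 ^ 2) -
        ((k : ℝ) * Real.sqrt (2 / 3) + (L.symm s) 2 - z₀ * (L.symm (EuclideanSpace.single (2 : Fin 3) (1 : ℝ))) 2) ^ 2)) /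
        (Real.sqrt 3 * (1 - (L.symm (EuclideanSpace.single (2 : Fin 3) (1 : ℝ))) 2 ^ 2)) - 1) ≤
      ((P.filter fun p => (∃ k ∈ K, ∃ i j : ℤ, p = L (barlowPos 1 (Real.sqrt (2 / 3)) σ k i j) + s) ∧
        p 2 ≤ z₀ ∧ z₀ < (p + L r) 2).card : ℝ) := by
  obtain ⟨α, β, α', β', r', hrr, hrr', hdet, hr'2, hdet34⟩ := inPlane_slot_basis hr hr2
  have hr1 : ‖r‖ = 1 := norm_eq_one_of_mem_fccSlots hr
  -- per layer
  set Pk : ℤ → Finset (EuclideanSpace ℝ (Fin 3)) := fun k => P.filter fun p =>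
    (∃ i j : ℤ, p = L (barlowPos 1 (Real.sqrt (2 / 3)) σ k 0 0 + (i : ℝ) • r + (j : ℝ) • r') + s) ∧
      p 2 ≤ z₀ ∧ z₀ < (p + L r) 2 with hPk
  have hbase2 : ∀ k : ℤ, (barlowPos 1 (Real.sqrt (2 / 3)) σ k 0 0 + L.symm s) 2 = (k : ℝ) * Real.sqrt (2 / 3) + (L.symm s) 2 := by
    intro k; rw [PiLp.add_apply, barlowPos_apply_two]
  have hk : ∀ k ∈ K, 4 * (L r) 2 * Real.sqrt (max 0 (R ^ 2 * (1 - (L.symm (EuclideanSpace.single (2 : Fin 3) (1 : ℝ))) 2 ^ 2) -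
        ((k : ℝ) * Real.sqrt (2 / 3) + (L.symm s) 2 - z₀ * (L.symm (EuclideanSpace.single (2 : Fin 3) (1 : ℝ))) 2) ^ 2)) /
        (Real.sqrt 3 * (1 - (L.symm (EuclideanSpace.single (2 : Fin 3) (1 : ℝ))) 2 ^ 2)) - 1 ≤ ((Pk k).card : ℝ) := by
    intro k hkK
    obtain ⟨hspan, hconv⟩ := layer_eq_span σ k hrr hrr' hdet
    have h := layer_tops_ge L s (barlowPos 1 (Real.sqrt (2 / 3)) σ k 0 0) r r' hr2 hr'2 hr1 hdet34 ha z₀ R hR P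
      (fun i j h1 h2 h3 => by
        rw [hconv] at h1 h2 h3 ⊢
        exact hP k hkK _ _ h1 h2 h3)
    rw [hbase2] at h
    exact h
  -- the per-layer sets are disjoint and contained in the target set
  have hsub : ∀ k ∈ K, Pk k ⊆ P.filter fun p => (∃ k ∈ K, ∃ i j : ℤ, p = L (barlowPos 1 (Real.sqrt (2 / 3)) σ k i j) + s) ∧
      p 2 ≤ z₀ ∧ z₀ < (p + L r) 2 := by
    intro k hkK p hp
    obtain ⟨hpP, ⟨i, j, hpij⟩, h1, h2⟩ := mem_filter.1 hp
    obtain ⟨-, hconv⟩ := layer_eq_span σ k hrr hrr' hdet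
    exact mem_filter.2 ⟨hpP, ⟨k, hkK, α * i + α' * j, β * i + β' * j, by rw [hpij, hconv]⟩, h1, h2⟩
  have hdisj : ∀ k₁ ∈ K, ∀ k₂ ∈ K, k₁ ≠ k₂ → Disjoint (Pk k₁) (Pk k₂) := by
    intro k₁ _ k₂ _ hne
    rw [Finset.disjoint_left]
    intro p hp₁ hp₂
    obtain ⟨-, ⟨i₁, j₁, e₁⟩, -, -⟩ := mem_filter.1 hp₁
    obtain ⟨-, ⟨i₂, j₂, e₂⟩, -, -⟩ := mem_filter.1 hp₂
    obtain ⟨-, hconv₁⟩ := layer_eq_span σ k₁ hrr hrr' hdet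
    obtain ⟨-, hconv₂⟩ := layer_eq_span σ k₂ hrr hrr' hdet
    rw [hconv₁] at e₁
    rw [hconv₂] at e₂
    rw [e₁] at e₂
    have := (barlowPos_injective σ (L.injective (add_right_cancel e₂))).1
    exact hne this
  calc ∑ k ∈ K, (4 * (L r) 2 * Real.sqrt (max 0 (R ^ 2 * (1 - (L.symm (EuclideanSpace.single (2 : Fin 3) (1 : ℝ))) 2 ^ 2) -
          ((k : ℝ) * Real.sqrt (2 / 3) + (L.symm s) 2 - z₀ * (L.symm (EuclideanSpace.single (2 : Fin 3) (1 : ℝ))) 2) ^ 2)) /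
          (Real.sqrt 3 * (1 - (L.symm (EuclideanSpace.single (2 : Fin 3) (1 : ℝ))) 2 ^ 2)) - 1)
      ≤ ∑ k ∈ K, ((Pk k).card : ℝ) := Finset.sum_le_sum hk
    _ = ((K.biUnion Pk).card : ℝ) := by rw [Finset.card_biUnion hdisj]; push_cast; rfl
    _ ≤ _ := by exact_mod_cast Finset.card_le_card (Finset.biUnion_subset.2 hsub)

open scoped Classical in
/-- **PLATE FIRST ENTRIES FROM ABOVE.**  See the module docstring. -/
theorem plate_firstAbove_le (z₁ R : ℝ) (hR : 0 ≤ R) (K : Finset ℤ) (Q : Finset (EuclideanSpace ℝ (Fin 3)))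
    (hQ : ∀ b ∈ Q, (∃ k ∈ K, ∃ i j : ℤ, b = L (barlowPos 1 (Real.sqrt (2 / 3)) σ k i j) + s) ∧ z₁ ≤ b 2 ∧ (b - L r) 2 < z₁ ∧
      b 0 ^ 2 + b 1 ^ 2 ≤ R ^ 2) :
    (Q.card : ℝ) ≤
      ∑ k ∈ K, (4 * (L r) 2 * Real.sqrt (max 0 ((R + 1) ^ 2 * (1 - (L.symm (EuclideanSpace.single (2 : Fin 3) (1 : ℝ))) 2 ^ 2) -
        ((k : ℝ) * Real.sqrt (2 / 3) + (L.symm s) 2 - z₁ * (L.symm (EuclideanSpace.single (2 : Fin 3) (1 : ℝ))) 2) ^ 2)) /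
        (Real.sqrt 3 * (1 - (L.symm (EuclideanSpace.single (2 : Fin 3) (1 : ℝ))) 2 ^ 2)) + 1) := by
  obtain ⟨α, β, α', β', r', hrr, hrr', hdet, hr'2, hdet34⟩ := inPlane_slot_basis hr hr2
  have hr1 : ‖r‖ = 1 := norm_eq_one_of_mem_fccSlots hr
  set Qk : ℤ → Finset (EuclideanSpace ℝ (Fin 3)) := fun k => Q.filter fun b =>
    ∃ i j : ℤ, b = L (barlowPos 1 (Real.sqrt (2 / 3)) σ k 0 0 + (i : ℝ) • r + (j : ℝ) • r') + s with hQk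
  have hbase2 : ∀ k : ℤ, (barlowPos 1 (Real.sqrt (2 / 3)) σ k 0 0 + L.symm s) 2 = (k : ℝ) * Real.sqrt (2 / 3) + (L.symm s) 2 := by
    intro k; rw [PiLp.add_apply, barlowPos_apply_two]
  have hk : ∀ k ∈ K, ((Qk k).card : ℝ) ≤
      4 * (L r) 2 * Real.sqrt (max 0 ((R + 1) ^ 2 * (1 - (L.symm (EuclideanSpace.single (2 : Fin 3) (1 : ℝ))) 2 ^ 2) -
        ((k : ℝ) * Real.sqrt (2 / 3) + (L.symm s) 2 - z₁ * (L.symm (EuclideanSpace.single (2 : Fin 3) (1 : ℝ))) 2) ^ 2)) /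
        (Real.sqrt 3 * (1 - (L.symm (EuclideanSpace.single (2 : Fin 3) (1 : ℝ))) 2 ^ 2)) + 1 := by
    intro k _
    have h := layer_firstAbove_le L s (barlowPos 1 (Real.sqrt (2 / 3)) σ k 0 0) r r' hr2 hr'2 hr1 hdet34 ha z₁ R hR (Qk k)
      (fun b hb => by
        obtain ⟨hbQ, hij⟩ := mem_filter.1 hb
        obtain ⟨-, h1, h2, h3⟩ := hQ b hbQ
        exact ⟨hij, h1, h2, h3⟩)
    rw [hbase2] at h
    exact h
  have hcover : Q ⊆ K.biUnion Qk := by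
    intro b hb
    obtain ⟨⟨k, hkK, x, y, hbxy⟩, -⟩ := hQ b hb
    obtain ⟨hspan, -⟩ := layer_eq_span σ k hrr hrr' hdet
    obtain ⟨i, j, hij⟩ := hspan x y
    exact mem_biUnion.2 ⟨k, hkK, mem_filter.2 ⟨hb, i, j, by rw [hbxy, hij]⟩⟩
  calc (Q.card : ℝ) ≤ ((K.biUnion Qk).card : ℝ) := by exact_mod_cast card_le_card hcover
    _ ≤ ∑ k ∈ K, ((Qk k).card : ℝ) := by exact_mod_cast card_biUnion_le
    _ ≤ _ := Finset.sum_le_sum hk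

end Plate

end Summit.Ventures.Crystal3D.Theorems

end
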